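/-
Copyright (c) 2026 the pub-hodgecm-mathlib formalisation cell (harness21).  Prover seat hodgecm-mathlib-K2E1-p10 (g6), Track B ∕ K2-LIT, h413 =
`stmt-HodgeConjecture-24833`, route `HCCMUnconditional`; R90-TF S8 «ContSpec-n½», (M) road RES-INT (M-a), this seat's census
`K2/K2E1-p10/g6/CENSUS-RES-INT-Ma.K2E1-p10-g6.md` e19e192b71e365b5 line 3 «CT-RES» (S8 dealer R90-CS-plan (g3) S8-R220 «meanwhile RES-INT»).
-/
import Literature.NumberTheory.Automorphic.UnitaryGroupBorelTruncation            -- ★ `borelConstantTerm` (the Borel constant term `(ν 𝓕)⁻¹ ∫_𝓕 φ(u g) dν`)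
import Literature.NumberTheory.Automorphic.UnitaryGroupBorelHeightContinuous      -- ★ `borelHeight`, `continuous_borelHeight`
import Literature.NumberTheory.Automorphic.UnitaryGroupTorusSiegelIntegral        -- ★ `borelHeight_pos`
import Literature.NumberTheory.Automorphic.UnitaryGroupQuasiSplitCMDatum          -- ★ `quasiSplit L⁺ L c 3` at a CM field (`quasiSplit_eq_cmDatum`, `rfl`)
import Literature.NumberTheory.Automorphic.AdelicUnitaryGroupDatum                -- ★ `locallyCompactSpace_cmDatum_Adelic`, `secondCountableTopology_cmDatum_Adelic`
import Mathlib.Analysis.Complex.AbsMax                                            -- Mathlib maximum modulus `Complex.norm_le_of_forall_mem_frontier_norm_le`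
import Mathlib.Analysis.Complex.CauchyIntegral                                    -- Mathlib Cauchy formula `DiffContOnCl.circleIntegral_sub_inv_smul`
import Mathlib.Analysis.SpecialFunctions.Pow.Continuity                           -- Mathlib `continuousAt_const_cpow`
import Mathlib.MeasureTheory.Integral.DominatedConvergence                        -- Mathlib dominated convergence for parametric interval integrals
import HarnessLib

/-!
# R90 · S8 «ContSpec-n½» — `R90S8ResidueConstantTermOfExportsU3`: «CT-RES» — THE CONSTANT TERM OF THE MIDDLE-POLE RESIDUE IS THE RESIDUE OF THE CONSTANT TERM,
# and the residue function `g ↦ Fp g (3∕2)` is CONTINUOUS — from ESTATE T's exported clauses (pole set `P`, analyticity and continuity off `P`, (E2-bd) joint local bound)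
# [MoeglinWaldspurger1995 IV.1.9–IV.1.11, V.3.13; Langlands1976 §7]

Cell `pub/hodgecm-mathlib`, crux H413 = `stmt-HodgeConjecture-24833` (lane `--kind proof --supports stmt-HodgeConjecture-24833 --as helper`), route of record
`HCCMUnconditional`; programme R90-TF, section S8, the (M) socket road RES-INT (M-a) (census e19e192b71e365b5 line 3).  THEOREMS ONLY: no `def`, no `instance`, no
`notation`, no named-fact hypothesis, no `sorry`, NO `Lines` import; default heartbeats.  CLOSES NO SOCKET.

THE MATHEMATICS.  Let `Ec z g` be THE continued Eisenstein family of a section (ESTATE T's export: a closed pole set `P`, co-discrete — in particular near `z₀ = 3∕2`,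
`∀ᶠ s in 𝓝[≠] z₀, s ∉ P` —, `z ↦ Ec z g` analytic off `P`, `Ec z` continuous in `g` off `P`, and (E2-bd) «for `z₁ ∉ P` and `K` compact there are `V ∈ 𝓝 z₁`, `M` with `‖Ec z g‖ ≤ M` on
`V × K`»), and `Fp g` the pole letter at `z₀` (analytic at `z₀`, `= (z − z₀)·Ec z g` on a punctured neighbourhood).  Then `F g z := (z − z₀)·Ec z g` extended by `Fp g z₀` at `z₀` is
analytic on a disc `|z − z₀| < r₀` UNIFORM in `g` (the punctured disc misses `P`); on a circle `|z − z₀| = r` the family `Ec` is bounded on `circle × K` (compactness of the circle +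
(E2-bd)), so `‖F g z‖ ≤ r·M` on the closed disc for `g ∈ K` (MAXIMUM MODULUS).  Consequently (§2) the constant term `z ↦ (ν𝓕)⁻¹ ∫_𝓕 F(u g)(z) dν(u)` is continuous at `z₀`
(DOMINATED CONVERGENCE over the compact piece `(closure 𝓕)·g`), and since for `z ≠ z₀` it equals `(z − z₀)·CT(Ec z)(g) = (z − z₀)·[φ g·H(g)^z + ψ_z g·H(g)^{2−z}]` (ℓ-CT's shape, ★
`ctPackage_of_scalarRoad`) with `(z − z₀)·ψ_z g → ρψ g`, its value at `z₀` — the constant term of the RESIDUE function `g ↦ Fp g z₀` — is `ρψ g·H(g)^{2−z₀}`: **CT(Res) = Res(CT)**;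
and (§3) `Fp g z₀ = (2πi)⁻¹ ∮_{|z−z₀|=r} Ec z g dz` (CAUCHY) is continuous in `g` (dominated convergence on the circle, same bound).  These are the two inputs of RES-INT's kernel step
(census lines 4–5): «`ρψ = 0` ⇒ the residue class is a continuous `L²` function with vanishing constant term ⇒ cuspidal AND residual ⇒ `0`» and conversely.

## CONTENTS (namespace `Summit.HodgeConjecture.HodgeConjecture.R90.S8`)
* §1 `exists_uniform_bound_of_locally_bounded` — compactness book-keeping: pointwise-local bounds on `S × K` (`S` compact) give one bound (Mathlib `IsCompact.induction_on`).
* §2 `differentiableOn_midPoleExtension`, `norm_midPoleExtension_le` — the extension `F` is holomorphic on the uniform disc; the maximum-modulus bound on `K × closedBall`.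
* §3 **`borelConstantTerm_midPoleLetter_eq`** — CT-RES: `borelConstantTerm ν 𝓕 (fun g => Fp g (3∕2)) g = ρψ g * H(g) ^ (2 − 3∕2)`, hypothesis-first on T's clauses `(P, hPdisc, hEcA, hEcc, hE2bd)`,
  D1's `(Fp, hFp, hFpE)` and ℓ-CT's `(φ, ψ, ρψ, hCT, hρψ)` (the shape asked only EVENTUALLY near `3∕2`, punctured); `𝓕` null-measurable with compact closure, `ν` finite on compacts.
* §4 **`continuous_midPoleLetter_apply`** — `Continuous fun g => Fp g (3∕2)` from T's clauses alone.
HONEST LABEL: HC_CM is proved only modulo the 7 printed citations (2 remaining named inputs: hLiu418 = `stmt-HodgeConjecture-24832`, h413 = `stmt-HodgeConjecture-24833`) until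
rung 0 closes; REL ≠ ★ ≠ BUILT; conditional by construction on T's exported clauses and ℓ-CT's package (all ★-SHAPED, plugged by name by the RES-INT kernel file); pays no socket;
count-neutral.

## References
* [MoeglinWaldspurger1995] C. Mœglin, J.-L. Waldspurger, *Spectral Decomposition and Eisenstein Series* (1995), I.2.6, IV.1.9–IV.1.11, V.3.13.
* [Langlands1976] R. P. Langlands, *On the Functional Equations Satisfied by Eisenstein Series*, LNM 544 (1976), §7.
* [Conway1978] J. B. Conway, *Functions of One Complex Variable*, 2nd ed., GTM 11 (1978), IV §3 (maximum modulus), IV §5 (Cauchy's formula).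
* [Rogawski1990] J. D. Rogawski, *Automorphic Representations of Unitary Groups in Three Variables* (1990), §13.9 p. 229 (ii).
-/

set_option autoImplicit false
-- the mandated namespace repeats the single-problem summit's segment (`HodgeConjecture.HodgeConjecture`)
set_option linter.dupNamespace false

noncomputable section

open MeasureTheory Measure Set Filter Topology NumberField Metric
open Literature.NumberTheory.Automorphic Literature.NumberTheory.Automorphic.UnitaryGroup Literature.NumberTheory.GaloisRepresentations AdelicGroupData
open scoped ENNReal NNReal Real

namespace Summit.HodgeConjecture.HodgeConjecture.R90.S8

/-! ## §1 Compactness book-keeping -/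

/-- **Pointwise-local bounds on a compact set give a uniform bound**: if every `z₁ ∈ S` (`S` compact) has a neighbourhood `V` and an `M` with `‖E z y‖ ≤ M` for `z ∈ V`, `y ∈ K`, then ONE
`M ≥ 0` bounds `‖E z y‖` on `S × K` (Mathlib `IsCompact.induction_on`). [cite: Conway1978, IV §3] -/
theorem exists_uniform_bound_of_locally_bounded {X Y : Type*} [TopologicalSpace X] {S : Set X} (hS : IsCompact S) (K : Set Y) (E : X → Y → ℂ)
    (h : ∀ z₁ ∈ S, ∃ V ∈ 𝓝 z₁, ∃ M : ℝ, ∀ z ∈ V, ∀ y ∈ K, ‖E z y‖ ≤ M) :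
    ∃ M : ℝ, 0 ≤ M ∧ ∀ z ∈ S, ∀ y ∈ K, ‖E z y‖ ≤ M := by
  have key : ∃ M : ℝ, ∀ z ∈ S, ∀ y ∈ K, ‖E z y‖ ≤ M := by
    refine hS.induction_on (p := fun T => ∃ M : ℝ, ∀ z ∈ T, ∀ y ∈ K, ‖E z y‖ ≤ M) ⟨0, fun z hz => hz.elim⟩ ?_ ?_ ?_
    · rintro T T' hTT' ⟨M, hM⟩
      exact ⟨M, fun z hz => hM z (hTT' hz)⟩
    · rintro T T' ⟨M, hM⟩ ⟨M', hM'⟩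
      exact ⟨max M M', fun z hz y hy => hz.elim (fun h => (hM z h y hy).trans (le_max_left _ _)) fun h => (hM' z h y hy).trans (le_max_right _ _)⟩
    · intro z₁ hz₁
      obtain ⟨V, hV, M, hM⟩ := h z₁ hz₁
      exact ⟨S ∩ V, Filter.inter_mem self_mem_nhdsWithin (mem_nhdsWithin_of_mem_nhds hV), M, fun z hz y hy => hM z hz.2 y hy⟩
  obtain ⟨M, hM⟩ := key
  exact ⟨max M 0, le_max_right _ _, fun z hz y hy => (hM z hz y hy).trans (le_max_left _ _)⟩

/-! ## §2 The uniform disc: the extension `F g := update (z ↦ (z − z₀)·Ec z g) z₀ (Fp g z₀)` is holomorphic on `|z − z₀| < r₀`; maximum modulus on `K × closedBall` -/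

section Disc

variable {Y : Type*} (Ec : ℂ → Y → ℂ) (P : Set ℂ) (Fp : Y → ℂ → ℂ) (z₀ : ℂ) {r₀ : ℝ}

/-- **The extension is holomorphic on the uniform disc.**  If the punctured disc `0 < |z − z₀| < r₀` misses `P`, `z ↦ Ec z y` is analytic off `P`, and `Fp y` is analytic at `z₀` and
`= (z − z₀)·Ec z y` on a punctured neighbourhood of `z₀`, then `Function.update (fun z => (z − z₀) * Ec z y) z₀ (Fp y z₀)` is differentiable on `ball z₀ r₀` — for EVERY `y`, with the SAME
`r₀`. [cite: Conway1978, IV §3] -/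
theorem differentiableOn_midPoleExtension (hP : ∀ s : ℂ, dist s z₀ < r₀ → s ≠ z₀ → s ∉ P)
    (hEcA : ∀ y (z : ℂ), z ∉ P → AnalyticAt ℂ (fun z => Ec z y) z)
    (hFp : ∀ y, AnalyticAt ℂ (Fp y) z₀) (hFpE : ∀ y, Fp y =ᶠ[𝓝[≠] z₀] fun z => (z - z₀) * Ec z y) (y : Y) :
    DifferentiableOn ℂ (Function.update (fun z => (z - z₀) * Ec z y) z₀ (Fp y z₀)) (ball z₀ r₀) := by
  intro z hz
  rw [mem_ball] at hz
  by_cases hzz : z = z₀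
  · -- at the centre: the extension agrees with `Fp y` near `z₀`
    subst hzz
    have heq : Function.update (fun w => (w - z) * Ec w y) z (Fp y z) =ᶠ[𝓝 z] Fp y := by
      have h1 : ∀ᶠ w in 𝓝 z, w ≠ z → Fp y w = (w - z) * Ec w y := eventually_nhdsWithin_iff.1 (hFpE y)
      filter_upwards [h1] with w hw
      by_cases hwz : w = z
      · subst hwz
        rw [Function.update_self]
      · rw [Function.update_of_ne hwz, hw hwz]
    exact ((hFp y).congr heq.symm).differentiableAt.differentiableWithinAt
  · -- off the centre: the extension agrees with `(w − z₀)·Ec w y` near `z`, analytic since `z ∉ P`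
    have hzP : z ∉ P := hP z hz hzz
    have hG : AnalyticAt ℂ (fun w => (w - z₀) * Ec w y) z := ((analyticAt_id.sub analyticAt_const).mul (hEcA y z hzP))
    have heq : Function.update (fun w => (w - z₀) * Ec w y) z₀ (Fp y z₀) =ᶠ[𝓝 z] fun w => (w - z₀) * Ec w y := by
      filter_upwards [isOpen_ne.mem_nhds hzz] with w hw
      rw [Function.update_of_ne hw]
    exact (hG.congr heq.symm).differentiableAt.differentiableWithinAt

/-- **Maximum modulus on the uniform disc.**  If moreover `‖Ec z y‖ ≤ M` for `z` on the circle `|z − z₀| = r` (`0 < r < r₀`) and `y ∈ K`, then `‖F y z‖ ≤ r·M` on `K × closedBall z₀ r`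
(Mathlib `Complex.norm_le_of_forall_mem_frontier_norm_le`). [cite: Conway1978, IV §3] -/
theorem norm_midPoleExtension_le (hP : ∀ s : ℂ, dist s z₀ < r₀ → s ≠ z₀ → s ∉ P)
    (hEcA : ∀ y (z : ℂ), z ∉ P → AnalyticAt ℂ (fun z => Ec z y) z)
    (hFp : ∀ y, AnalyticAt ℂ (Fp y) z₀) (hFpE : ∀ y, Fp y =ᶠ[𝓝[≠] z₀] fun z => (z - z₀) * Ec z y)
    {r : ℝ} (hr : 0 < r) (hrr₀ : r < r₀) {K : Set Y} {M : ℝ} (hM : ∀ z ∈ sphere z₀ r, ∀ y ∈ K, ‖Ec z y‖ ≤ M)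
    {y : Y} (hy : y ∈ K) {z : ℂ} (hz : z ∈ closedBall z₀ r) :
    ‖Function.update (fun z => (z - z₀) * Ec z y) z₀ (Fp y z₀) z‖ ≤ r * M := by
  have hdiff := differentiableOn_midPoleExtension Ec P Fp z₀ hP hEcA hFp hFpE y
  have hdc : DiffContOnCl ℂ (Function.update (fun z => (z - z₀) * Ec z y) z₀ (Fp y z₀)) (ball z₀ r) :=
    DifferentiableOn.diffContOnCl (by
      rw [closure_ball z₀ hr.ne']
      exact hdiff.mono (closedBall_subset_ball hrr₀))
  refine Complex.norm_le_of_forall_mem_frontier_norm_le isBounded_ball hdc (fun w hw => ?_) (by rwa [closure_ball z₀ hr.ne'])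
  rw [frontier_ball z₀ hr.ne'] at hw
  have hw0 : w ≠ z₀ := by
    intro h
    rw [h, mem_sphere, dist_self] at hw
    exact hr.ne' hw.symm
  have hwr : ‖w - z₀‖ = r := by rwa [← dist_eq_norm, ← mem_sphere]
  rw [Function.update_of_ne hw0, norm_mul, hwr]
  exact mul_le_mul_of_nonneg_left (hM w hw y hy) hr.le

end Disc

/-! ## §3 CT-RES: the constant term of the residue function [MoeglinWaldspurger1995 IV.1.9–IV.1.11, V.3.13] -/

section CTRes

variable (L : Type) [Field L] [NumberField L] [IsCMField L]
  [MeasurableSpace (quasiSplit (↥(maximalRealSubfield L)) L (IsCMField.complexConj L) 3).Adelic] [BorelSpace (quasiSplit (↥(maximalRealSubfield L)) L (IsCMField.complexConj L) 3).Adelic]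

/-- **CT-RES — THE CONSTANT TERM OF THE MIDDLE-POLE RESIDUE IS THE RESIDUE OF THE CONSTANT TERM.**  Hypothesis-first on: ESTATE T's exported clauses at the continued family `Ec`
(`hPdisc` = its «`∀ z₀, ∀ᶠ s in 𝓝[≠] z₀, s ∉ P`» AT `3∕2`; `hEcA` analyticity off `P`; `hEcc` continuity in `g` off `P`; `hE2bd` the joint local bound off `P` — ★
`chiEisenstein_meromorphic_exports_kfinite_cm_three_of_gauge_letters`'s last clauses BYTE FOR BYTE), D1's pole letter `(Fp, hFp, hFpE)` at `3∕2` (★ `resGMidAtomGen`'s clauses), and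
ℓ-CT's package `(φ, ψ, ρψ)` (★ `ctPackage_of_scalarRoad`: the shape `(Ec z)_B g = φ g·H(g)^z + ψ_z g·H(g)^{2−z}` — asked here only EVENTUALLY in `𝓝[≠] (3∕2)`, which the slit-plane form
implies since `Sp` is finite — and `(z − 3∕2)·ψ_z g → ρψ g`); `𝓕` null-measurable with compact closure, `ν` finite on compacts (both from the Heisenberg package of record).  CONCLUSION:
`borelConstantTerm ν 𝓕 (fun g => Fp g (3∕2)) g = ρψ g * H(g) ^ (2 − 3∕2)` — the profile `ψt` of ★ ℓ-CT, i.e. `(M₋₁φ)(g)·H(g)^{1∕2}` with `M₋₁φ = ρ·φt(3∕2)`.  PROOF: §2's uniform disc +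
maximum modulus over the compact `(closure 𝓕)·g`, then dominated convergence for `z ↦ ∫_𝓕 F(u g)(z) dν(u)` along `𝓝[≠] (3∕2)`, where the integrand is `(z − 3∕2)·CT(Ec z)`.
[cite: MoeglinWaldspurger1995, IV.1.9–IV.1.11, V.3.13] [cite: Langlands1976, §7] [cite: Conway1978, IV §3] -/
theorem borelConstantTerm_midPoleLetter_eq
    (ν : Measure ↥(adelicUnipotent (↥(maximalRealSubfield L)) L (IsCMField.complexConj L) 3)) [IsFiniteMeasureOnCompacts ν]
    {𝓕 : Set ↥(adelicUnipotent (↥(maximalRealSubfield L)) L (IsCMField.complexConj L) 3)} (h𝓕ν : NullMeasurableSet 𝓕 ν) (h𝓕c : IsCompact (closure 𝓕))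
    (Ec : ℂ → (quasiSplit (↥(maximalRealSubfield L)) L (IsCMField.complexConj L) 3).Adelic → ℂ) (P : Set ℂ)
    (hPdisc : ∀ᶠ s in 𝓝[≠] ((3 : ℂ) / 2), s ∉ P)
    (hEcA : ∀ g (z : ℂ), z ∉ P → AnalyticAt ℂ (fun z => Ec z g) z)
    (hEcc : ∀ z : ℂ, z ∉ P → Continuous (Ec z))
    (hE2bd : ∀ z₁ : ℂ, z₁ ∉ P → ∀ K : Set (quasiSplit (↥(maximalRealSubfield L)) L (IsCMField.complexConj L) 3).Adelic, IsCompact K →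
      ∃ V ∈ 𝓝 z₁, ∃ M : ℝ, ∀ z ∈ V, ∀ g ∈ K, ‖Ec z g‖ ≤ M)
    (Fp : (quasiSplit (↥(maximalRealSubfield L)) L (IsCMField.complexConj L) 3).Adelic → ℂ → ℂ) (hFp : ∀ g, AnalyticAt ℂ (Fp g) ((3 : ℂ) / 2))
    (hFpE : ∀ g, Fp g =ᶠ[𝓝[≠] ((3 : ℂ) / 2)] fun z => (z - (3 : ℂ) / 2) * Ec z g)
    (φ : (quasiSplit (↥(maximalRealSubfield L)) L (IsCMField.complexConj L) 3).Adelic → ℂ) (ψ : ℂ → (quasiSplit (↥(maximalRealSubfield L)) L (IsCMField.complexConj L) 3).Adelic → ℂ)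
    (ρψ : (quasiSplit (↥(maximalRealSubfield L)) L (IsCMField.complexConj L) 3).Adelic → ℂ)
    (hCT : ∀ᶠ z in 𝓝[≠] ((3 : ℂ) / 2), ∀ g : (quasiSplit (↥(maximalRealSubfield L)) L (IsCMField.complexConj L) 3).Adelic,
      borelConstantTerm ν 𝓕 (Ec z) g = φ g * (((borelHeight g : ℝ≥0) : ℝ) : ℂ) ^ z + ψ z g * (((borelHeight g : ℝ≥0) : ℝ) : ℂ) ^ (2 - z))
    (hρψ : ∀ g, Tendsto (fun z : ℂ => (z - (3 : ℂ) / 2) * ψ z g) (𝓝[≠] ((3 : ℂ) / 2)) (𝓝 (ρψ g)))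
    (g : (quasiSplit (↥(maximalRealSubfield L)) L (IsCMField.complexConj L) 3).Adelic) :
    borelConstantTerm ν 𝓕 (fun y => Fp y ((3 : ℂ) / 2)) g = ρψ g * (((borelHeight g : ℝ≥0) : ℝ) : ℂ) ^ (2 - (3 : ℂ) / 2) := by
  set z₀ : ℂ := (3 : ℂ) / 2 with hz₀
  -- Step 0: a uniform radius `r₀` whose punctured disc misses `P`
  obtain ⟨r₀, hr₀, hP⟩ : ∃ r₀ > 0, ∀ s : ℂ, dist s z₀ < r₀ → s ≠ z₀ → s ∉ P := by
    obtain ⟨ε, hε, h⟩ := Metric.eventually_nhds_iff.1 (eventually_nhdsWithin_iff.1 hPdisc)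
    exact ⟨ε, hε, fun s hs hne => h hs hne⟩
  -- the extension `F y` and its holomorphy on the uniform disc
  set F : (quasiSplit (↥(maximalRealSubfield L)) L (IsCMField.complexConj L) 3).Adelic → ℂ → ℂ :=
    fun y => Function.update (fun z => (z - z₀) * Ec z y) z₀ (Fp y z₀) with hF
  have hFdiff : ∀ y, DifferentiableOn ℂ (F y) (ball z₀ r₀) := differentiableOn_midPoleExtension Ec P Fp z₀ hP hEcA hFp hFpE
  have hFne : ∀ y (z : ℂ), z ≠ z₀ → F y z = (z - z₀) * Ec z y := fun y z hz => by
    simp only [hF]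
    exact Function.update_of_ne hz _ _
  have hFz₀ : ∀ y, F y z₀ = Fp y z₀ := fun y => by
    simp only [hF]
    exact Function.update_self _ _ _
  -- Step 1: the compact piece `(closure 𝓕)·g` and the uniform circle bound
  set K : Set (quasiSplit (↥(maximalRealSubfield L)) L (IsCMField.complexConj L) 3).Adelic :=
    (fun u : ↥(adelicUnipotent (↥(maximalRealSubfield L)) L (IsCMField.complexConj L) 3) =>
      (u : (quasiSplit (↥(maximalRealSubfield L)) L (IsCMField.complexConj L) 3).Adelic) * g) '' closure 𝓕 with hK
  have hKc : IsCompact K := h𝓕c.image (continuous_subtype_val.mul continuous_const)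
  set r : ℝ := r₀ / 2 with hr
  have hrpos : 0 < r := by positivity
  have hrr₀ : r < r₀ := by rw [hr]; linarith
  obtain ⟨M, hM0, hM⟩ : ∃ M : ℝ, 0 ≤ M ∧ ∀ z ∈ sphere z₀ r, ∀ y ∈ K, ‖Ec z y‖ ≤ M := by
    refine exists_uniform_bound_of_locally_bounded (isCompact_sphere z₀ r) K Ec fun z₁ hz₁ => ?_
    have hz₁P : z₁ ∉ P := by
      refine hP z₁ ?_ ?_
      · rw [mem_sphere] at hz₁
        rw [hz₁]; exact hrr₀
      · intro h
        rw [h, mem_sphere, dist_self] at hz₁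
        exact hrpos.ne' hz₁.symm
    exact hE2bd z₁ hz₁P K hKc
  have hmax : ∀ y ∈ K, ∀ z ∈ closedBall z₀ r, ‖F y z‖ ≤ r * M := fun y hy z hz =>
    norm_midPoleExtension_le Ec P Fp z₀ hP hEcA hFp hFpE hrpos hrr₀ hM hy hz
  -- Step 2: dominated convergence for `I z := ∫_𝓕 F (u g) z dν` along `𝓝[≠] z₀`
  have h𝓕fin : ν 𝓕 < ∞ := (measure_mono subset_closure).trans_lt h𝓕c.measure_lt_top
  haveI : IsFiniteMeasure (ν.restrict 𝓕) := isFiniteMeasure_restrict.2 h𝓕fin.ne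
  have hev : ∀ᶠ z in 𝓝[≠] z₀, z ≠ z₀ ∧ dist z z₀ < r := by
    filter_upwards [self_mem_nhdsWithin, mem_nhdsWithin_of_mem_nhds (ball_mem_nhds z₀ hrpos)] with z hz hz'
    exact ⟨hz, mem_ball.1 hz'⟩
  have hlim : Tendsto (fun z => ∫ u in 𝓕, F ((u : (quasiSplit (↥(maximalRealSubfield L)) L (IsCMField.complexConj L) 3).Adelic) * g) z ∂ν)
      (𝓝[≠] z₀) (𝓝 (∫ u in 𝓕, F ((u : (quasiSplit (↥(maximalRealSubfield L)) L (IsCMField.complexConj L) 3).Adelic) * g) z₀ ∂ν)) := by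
    refine tendsto_integral_filter_of_dominated_convergence (fun _ => r * M) ?_ ?_ (integrable_const _) ?_
    · -- measurability: for `z ≠ z₀` in the disc the integrand is `(z − z₀)·Ec z (u g)`, continuous in `u`
      filter_upwards [hev] with z hz
      have hzP : z ∉ P := hP z (hz.2.trans hrr₀) hz.1
      have hcont : Continuous fun u : ↥(adelicUnipotent (↥(maximalRealSubfield L)) L (IsCMField.complexConj L) 3) =>
          (z - z₀) * Ec z ((u : (quasiSplit (↥(maximalRealSubfield L)) L (IsCMField.complexConj L) 3).Adelic) * g) :=
        continuous_const.mul ((hEcc z hzP).comp (continuous_subtype_val.mul continuous_const))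
      exact (hcont.aestronglyMeasurable).congr (Filter.Eventually.of_forall fun u => (hFne _ z hz.1).symm)
    · -- domination by `r·M` on the punctured disc (`u ∈ 𝓕` a.e. for `ν|_𝓕`, so `u g ∈ K`)
      filter_upwards [hev] with z hz
      filter_upwards [ae_restrict_mem₀ h𝓕ν] with u hu
      exact hmax _ ⟨u, subset_closure hu, rfl⟩ z (mem_closedBall.2 hz.2.le)
    · -- pointwise convergence: `F (u g)` is continuous at `z₀`
      refine Filter.Eventually.of_forall fun u => ?_
      exact (((hFdiff _).differentiableAt (ball_mem_nhds z₀ hr₀)).continuousAt.tendsto).mono_left nhdsWithin_le_nhds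
  -- Step 3: for `z ≠ z₀` near `z₀`, `(ν𝓕)⁻¹ • I z = (z − z₀)·[φ g·H^z + ψ_z g·H^{2−z}]`
  have hH0 : ((((borelHeight g : ℝ≥0) : ℝ) : ℂ)) ≠ 0 := by
    exact_mod_cast (borelHeight_pos g).ne'
  have hI : ∀ᶠ z in 𝓝[≠] z₀, ((ν 𝓕).toReal⁻¹ : ℝ) • (∫ u in 𝓕, F ((u : (quasiSplit (↥(maximalRealSubfield L)) L (IsCMField.complexConj L) 3).Adelic) * g) z ∂ν) =
      (z - z₀) * (φ g * (((borelHeight g : ℝ≥0) : ℝ) : ℂ) ^ z + ψ z g * (((borelHeight g : ℝ≥0) : ℝ) : ℂ) ^ (2 - z)) := by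
    filter_upwards [hev, hCT] with z hz hCTz
    have hint : (∫ u in 𝓕, F ((u : (quasiSplit (↥(maximalRealSubfield L)) L (IsCMField.complexConj L) 3).Adelic) * g) z ∂ν) =
        (z - z₀) * ∫ u in 𝓕, Ec z ((u : (quasiSplit (↥(maximalRealSubfield L)) L (IsCMField.complexConj L) 3).Adelic) * g) ∂ν := by
      rw [← integral_const_mul]
      exact integral_congr_ae (Filter.Eventually.of_forall fun u => hFne _ z hz.1)
    rw [hint, ← mul_smul_comm, ← hCTz g, borelConstantTerm_def]
  -- Step 4: the right-hand side tends to `ρψ g·H^{2−z₀}`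
  have hR : Tendsto (fun z : ℂ => (z - z₀) * (φ g * (((borelHeight g : ℝ≥0) : ℝ) : ℂ) ^ z + ψ z g * (((borelHeight g : ℝ≥0) : ℝ) : ℂ) ^ (2 - z)))
      (𝓝[≠] z₀) (𝓝 (ρψ g * (((borelHeight g : ℝ≥0) : ℝ) : ℂ) ^ (2 - z₀))) := by
    have h1 : Tendsto (fun z : ℂ => z - z₀) (𝓝[≠] z₀) (𝓝 0) := by
      have h : Tendsto (fun z : ℂ => id z - z₀) (𝓝[≠] z₀) (𝓝 (z₀ - z₀)) :=
        (tendsto_nhdsWithin_of_tendsto_nhds tendsto_id).sub_const z₀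
      rw [sub_self] at h
      exact h
    have h2 : Tendsto (fun z : ℂ => (((borelHeight g : ℝ≥0) : ℝ) : ℂ) ^ z) (𝓝[≠] z₀) (𝓝 ((((borelHeight g : ℝ≥0) : ℝ) : ℂ) ^ z₀)) :=
      (continuousAt_const_cpow hH0).tendsto.mono_left nhdsWithin_le_nhds
    have h3 : Tendsto (fun z : ℂ => (((borelHeight g : ℝ≥0) : ℝ) : ℂ) ^ (2 - z)) (𝓝[≠] z₀) (𝓝 ((((borelHeight g : ℝ≥0) : ℝ) : ℂ) ^ (2 - z₀))) := by
      have hc : ContinuousAt (fun z : ℂ => (((borelHeight g : ℝ≥0) : ℝ) : ℂ) ^ (2 - z)) z₀ :=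
        ContinuousAt.comp (g := fun w : ℂ => (((borelHeight g : ℝ≥0) : ℝ) : ℂ) ^ w) (continuousAt_const_cpow hH0)
          (continuous_const.sub continuous_id).continuousAt
      exact hc.tendsto.mono_left nhdsWithin_le_nhds
    have hsum : Tendsto (fun z : ℂ => (z - z₀) * φ g * (((borelHeight g : ℝ≥0) : ℝ) : ℂ) ^ z + ((z - z₀) * ψ z g) * (((borelHeight g : ℝ≥0) : ℝ) : ℂ) ^ (2 - z))
        (𝓝[≠] z₀) (𝓝 (0 * φ g * (((borelHeight g : ℝ≥0) : ℝ) : ℂ) ^ z₀ + ρψ g * (((borelHeight g : ℝ≥0) : ℝ) : ℂ) ^ (2 - z₀))) :=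
      ((h1.mul_const _).mul h2).add ((hρψ g).mul h3)
    rw [zero_mul, zero_mul, zero_add] at hsum
    refine hsum.congr fun z => ?_
    ring
  -- Step 5: uniqueness of limits
  have hlim' : Tendsto (fun z => ((ν 𝓕).toReal⁻¹ : ℝ) • ∫ u in 𝓕, F ((u : (quasiSplit (↥(maximalRealSubfield L)) L (IsCMField.complexConj L) 3).Adelic) * g) z ∂ν)
      (𝓝[≠] z₀) (𝓝 (ρψ g * (((borelHeight g : ℝ≥0) : ℝ) : ℂ) ^ (2 - z₀))) :=
    hR.congr' (hI.mono fun z hz => hz.symm)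
  have heq := tendsto_nhds_unique (hlim.const_smul ((ν 𝓕).toReal⁻¹ : ℝ)) hlim'
  rw [borelConstantTerm_def]
  have hint₀ : (∫ u in 𝓕, Fp ((u : (quasiSplit (↥(maximalRealSubfield L)) L (IsCMField.complexConj L) 3).Adelic) * g) z₀ ∂ν) =
      ∫ u in 𝓕, F ((u : (quasiSplit (↥(maximalRealSubfield L)) L (IsCMField.complexConj L) 3).Adelic) * g) z₀ ∂ν :=
    integral_congr_ae (Filter.Eventually.of_forall fun u => (hFz₀ _).symm)
  rw [hint₀]
  exact heq

/-! ## §4 Continuity of the residue function `g ↦ Fp g (3∕2)` (Cauchy's formula on the uniform circle) -/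

omit [MeasurableSpace (quasiSplit (↥(maximalRealSubfield L)) L (IsCMField.complexConj L) 3).Adelic]
  [BorelSpace (quasiSplit (↥(maximalRealSubfield L)) L (IsCMField.complexConj L) 3).Adelic] in
/-- **THE RESIDUE FUNCTION IS CONTINUOUS.**  From ESTATE T's clauses alone (`hPdisc`, `hEcA`, `hEcc`, `hE2bd`) and D1's pole letter: `g ↦ Fp g (3∕2)` is continuous on `G(𝔸)` —
`Fp g (3∕2) = (2πi)⁻¹ ∮_{|z − 3∕2| = r} Ec z g dz` (Cauchy's formula for §2's extension on the uniform disc, Mathlib `DiffContOnCl.circleIntegral_sub_inv_smul`), and the circle integral is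
continuous in `g` by dominated convergence (bound `r·M` from (E2-bd) on `circle × K`, `K` a compact neighbourhood — `G(𝔸)` is locally compact, ★ `locallyCompactSpace_cmDatum_Adelic`).
Needed by RES-INT's kernel step to place the residue class in ★ `cuspForms` (continuous representatives). [cite: Conway1978, IV §5] [cite: MoeglinWaldspurger1995, IV.1.11] -/
theorem continuous_midPoleLetter_apply
    (Ec : ℂ → (quasiSplit (↥(maximalRealSubfield L)) L (IsCMField.complexConj L) 3).Adelic → ℂ) (P : Set ℂ)
    (hPdisc : ∀ᶠ s in 𝓝[≠] ((3 : ℂ) / 2), s ∉ P)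
    (hEcA : ∀ g (z : ℂ), z ∉ P → AnalyticAt ℂ (fun z => Ec z g) z)
    (hEcc : ∀ z : ℂ, z ∉ P → Continuous (Ec z))
    (hE2bd : ∀ z₁ : ℂ, z₁ ∉ P → ∀ K : Set (quasiSplit (↥(maximalRealSubfield L)) L (IsCMField.complexConj L) 3).Adelic, IsCompact K →
      ∃ V ∈ 𝓝 z₁, ∃ M : ℝ, ∀ z ∈ V, ∀ g ∈ K, ‖Ec z g‖ ≤ M)
    (Fp : (quasiSplit (↥(maximalRealSubfield L)) L (IsCMField.complexConj L) 3).Adelic → ℂ → ℂ) (hFp : ∀ g, AnalyticAt ℂ (Fp g) ((3 : ℂ) / 2))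
    (hFpE : ∀ g, Fp g =ᶠ[𝓝[≠] ((3 : ℂ) / 2)] fun z => (z - (3 : ℂ) / 2) * Ec z g) :
    Continuous fun g : (quasiSplit (↥(maximalRealSubfield L)) L (IsCMField.complexConj L) 3).Adelic => Fp g ((3 : ℂ) / 2) := by
  haveI : LocallyCompactSpace (quasiSplit (↥(maximalRealSubfield L)) L (IsCMField.complexConj L) 3).Adelic :=
    locallyCompactSpace_cmDatum_Adelic L 3 ((StdForm.antidiagonal 3).over L)
  haveI : SecondCountableTopology (quasiSplit (↥(maximalRealSubfield L)) L (IsCMField.complexConj L) 3).Adelic :=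
    secondCountableTopology_cmDatum_Adelic L 3 ((StdForm.antidiagonal 3).over L)
  set z₀ : ℂ := (3 : ℂ) / 2 with hz₀
  obtain ⟨r₀, hr₀, hP⟩ : ∃ r₀ > 0, ∀ s : ℂ, dist s z₀ < r₀ → s ≠ z₀ → s ∉ P := by
    obtain ⟨ε, hε, h⟩ := Metric.eventually_nhds_iff.1 (eventually_nhdsWithin_iff.1 hPdisc)
    exact ⟨ε, hε, fun s hs hne => h hs hne⟩
  set F : (quasiSplit (↥(maximalRealSubfield L)) L (IsCMField.complexConj L) 3).Adelic → ℂ → ℂ :=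
    fun y => Function.update (fun z => (z - z₀) * Ec z y) z₀ (Fp y z₀) with hF
  have hFdiff : ∀ y, DifferentiableOn ℂ (F y) (ball z₀ r₀) := differentiableOn_midPoleExtension Ec P Fp z₀ hP hEcA hFp hFpE
  have hFne : ∀ y (z : ℂ), z ≠ z₀ → F y z = (z - z₀) * Ec z y := fun y z hz => by
    simp only [hF]
    exact Function.update_of_ne hz _ _
  have hFz₀ : ∀ y, F y z₀ = Fp y z₀ := fun y => by
    simp only [hF]
    exact Function.update_self _ _ _
  set r : ℝ := r₀ / 2 with hr
  have hrpos : 0 < r := by positivity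
  have hrr₀ : r < r₀ := by rw [hr]; linarith
  have hsphP : ∀ z ∈ sphere z₀ r, z ∉ P := by
    intro z hz
    refine hP z ?_ ?_
    · rw [mem_sphere] at hz
      rw [hz]; exact hrr₀
    · intro h
      rw [h, mem_sphere, dist_self] at hz
      exact hrpos.ne' hz.symm
  -- Cauchy: `Fp y z₀ = (2πi)⁻¹ • ∮ Ec z y dz` for every `y`
  have hcauchy : ∀ y, Fp y z₀ = (2 * ↑π * Complex.I)⁻¹ • ∮ z in C(z₀, r), Ec z y := by
    intro y
    have hdc : DiffContOnCl ℂ (F y) (ball z₀ r) :=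
      DifferentiableOn.diffContOnCl (by
        rw [closure_ball z₀ hrpos.ne']
        exact (hFdiff y).mono (closedBall_subset_ball hrr₀))
    have hC := hdc.two_pi_i_inv_smul_circleIntegral_sub_inv_smul (mem_ball_self hrpos)
    have hC' : (∮ z in C(z₀, r), (z - z₀)⁻¹ • F y z) = ∮ z in C(z₀, r), Ec z y := by
      refine circleIntegral.integral_congr hrpos.le fun z hz => ?_
      have hz0 : z ≠ z₀ := by
        intro h
        rw [h, mem_sphere, dist_self] at hz
        exact hrpos.ne' hz.symm
      show (z - z₀)⁻¹ • F y z = Ec z y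
      rw [hFne y z hz0, smul_eq_mul, ← mul_assoc, inv_mul_cancel₀ (sub_ne_zero.2 hz0), one_mul]
    rw [hC', hFz₀ y] at hC
    exact hC.symm
  have hfun : (fun g : (quasiSplit (↥(maximalRealSubfield L)) L (IsCMField.complexConj L) 3).Adelic => Fp g z₀) =
      fun g => (2 * ↑π * Complex.I)⁻¹ • ∮ z in C(z₀, r), Ec z g := funext hcauchy
  rw [hfun]
  suffices hcont : Continuous fun g : (quasiSplit (↥(maximalRealSubfield L)) L (IsCMField.complexConj L) 3).Adelic => ∮ z in C(z₀, r), Ec z g by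
    simpa only [Pi.smul_def] using hcont.const_smul ((2 * ↑π * Complex.I)⁻¹ : ℂ)
  refine continuous_iff_continuousAt.2 fun y₀ => ?_
  -- dominated convergence on the circle near `y₀`, inside a compact neighbourhood `K`
  obtain ⟨K, hKc, hKy₀⟩ := exists_compact_mem_nhds y₀
  obtain ⟨M, hM0, hM⟩ : ∃ M : ℝ, 0 ≤ M ∧ ∀ z ∈ sphere z₀ r, ∀ y ∈ K, ‖Ec z y‖ ≤ M :=
    exists_uniform_bound_of_locally_bounded (isCompact_sphere z₀ r) K Ec fun z₁ hz₁ => hE2bd z₁ (hsphP z₁ hz₁) K hKc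
  simp only [circleIntegral]
  refine intervalIntegral.continuousAt_of_dominated_interval (bound := fun _ => r * M) ?_ ?_ intervalIntegrable_const ?_
  · -- measurability in `θ`: the integrand is continuous in `θ`
    refine Filter.Eventually.of_forall fun y => Continuous.aestronglyMeasurable ?_
    have hderiv : Continuous fun θ : ℝ => deriv (circleMap z₀ r) θ := by
      simp only [deriv_circleMap]
      exact (continuous_circleMap 0 r).mul continuous_const
    have hEcθ : Continuous fun θ : ℝ => Ec (circleMap z₀ r θ) y :=
      continuous_iff_continuousAt.2 fun θ =>
        ContinuousAt.comp (g := fun z : ℂ => Ec z y) ((hEcA y _ (hsphP _ (circleMap_mem_sphere z₀ hrpos.le θ))).continuousAt)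
          (continuous_circleMap z₀ r).continuousAt
    exact hderiv.smul hEcθ
  · -- domination by `r·M` for `y ∈ K`
    filter_upwards [hKy₀] with y hy
    refine Filter.Eventually.of_forall fun θ _ => ?_
    rw [norm_smul, deriv_circleMap, norm_mul, Complex.norm_I, mul_one, norm_circleMap_zero, abs_of_pos hrpos]
    exact mul_le_mul_of_nonneg_left (hM _ (circleMap_mem_sphere z₀ hrpos.le θ) y hy) hrpos.le
  · -- continuity in `y` at `y₀` for each `θ`
    refine Filter.Eventually.of_forall fun θ _ => ?_
    have h : ContinuousAt (fun y : (quasiSplit (↥(maximalRealSubfield L)) L (IsCMField.complexConj L) 3).Adelic => Ec (circleMap z₀ r θ) y) y₀ :=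
      (hEcc _ (hsphP _ (circleMap_mem_sphere z₀ hrpos.le θ))).continuousAt
    exact h.const_smul (deriv (circleMap z₀ r) θ)

end CTRes

end Summit.HodgeConjecture.HodgeConjecture.R90.S8

end
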